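import Mathlib
import Summits.Ventures.PercRepro2.K5HyperK3

/-!
# THE STAR CERTIFICATES OF THE CRUX KERNEL `K₃` ON `K₅`: THE SHAPES (blind cell PercRepro2, p2 g2,
2026-08-25; typer-1's vocabulary — `K5Hyper.lean` masks and `kron3`, `K5K3Kernel.lean` tables; the
pieces `pM` / `pB` of TypedStarPieces.lean)

`posOn3b b` / `negOn3b b` are typer-1's `posOn3` / `negOn3` (the ten positive / ten negative products of
`K₃` through the three masks) at the marking `(0, 1, 2, 3, b)`, `b ∈ {4, 3, 0}` (`posOn3b 4 = posOn3`);
`sumM f D S` = `M(H, T, e)` (the triangle `D` in one copy, the pair `S` in another: six ordered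
placements), `sumB f S₁ S₂ S₃` = the three pairs in the three copies (six placements).  The
certificates (`K5StarCertM*.lean`, `K5StarCertB*.lean`): `CertLE (sumM negOn3b …) (sumM posOn3b …)`
(120 products) and `CertLE (sumB … + sumM …) (…)` (240 products) — one `decide +kernel` each.
-/

namespace Summit.Ventures.PercRepro2

namespace K5

/-- The positive products of `K₃` on the pattern `(S₁, S₂, S₃)` at the marking `(0, 1, 2, 3, b)`. -/
def posOn3b (b : ℕ) (S₁ S₂ S₃ : Fin 10 → Bool) : ℕ :=
  kron3 tPD S₁ * kron3 tQ S₂ * kron3 (t4p b) S₃ + kron3 tQ S₁ * kron3 tPDoU S₂ * kron3 (t5p b) S₃ +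
    kron3 tPD S₁ * kron3 tQ S₂ * kron3 (t6m b) S₃ +
    kron3 tPD S₁ * kron3 (t7p b) S₂ * kron3 (t7m 0) S₃ + kron3 tPD S₁ * kron3 (t7m b) S₂ * kron3 (t7p 0) S₃ +
    kron3 tPDoU S₁ * kron3 (t7p b) S₂ * kron3 (t7m 3) S₃ + kron3 tPDoU S₁ * kron3 (t7m b) S₂ * kron3 (t7p 3) S₃ +
    kron3 tPD S₁ * kron3 (t7p b) S₂ * kron3 t10p S₃ + kron3 tPD S₁ * kron3 (t7m b) S₂ * kron3 t10m S₃ +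
    kron3 tQ S₁ * kron3 (t12 b) S₂ * kron3 tPDoU S₃

/-- The negative products of `K₃` on the pattern `(S₁, S₂, S₃)` at the marking `(0, 1, 2, 3, b)`. -/
def negOn3b (b : ℕ) (S₁ S₂ S₃ : Fin 10 → Bool) : ℕ :=
  kron3 tPD S₁ * kron3 tQ S₂ * kron3 (t4m b) S₃ + kron3 tQ S₁ * kron3 tPDoU S₂ * kron3 (t5m b) S₃ +
    kron3 tPD S₁ * kron3 tQ S₂ * kron3 (t6p b) S₃ +
    kron3 tPD S₁ * kron3 (t7p b) S₂ * kron3 (t7p 0) S₃ + kron3 tPD S₁ * kron3 (t7m b) S₂ * kron3 (t7m 0) S₃ +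
    kron3 tPDoU S₁ * kron3 (t7p b) S₂ * kron3 (t7p 3) S₃ + kron3 tPDoU S₁ * kron3 (t7m b) S₂ * kron3 (t7m 3) S₃ +
    kron3 tPD S₁ * kron3 (t7p b) S₂ * kron3 t10m S₃ + kron3 tPD S₁ * kron3 (t7m b) S₂ * kron3 t10p S₃ +
    kron3 tPD S₁ * kron3 tQ S₂ * kron3 (t11 b) S₃

/-- At the distinct marking these are typer-1's `posOn3`. -/
theorem posOn3b_four : posOn3b 4 = posOn3 := rfl

/-- At the distinct marking these are typer-1's `negOn3`. -/
theorem negOn3b_four : negOn3b 4 = negOn3 := rfl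

/-- `M(H, T, e)`: the triangle `D` in one copy, the pair `S` in another (six ordered placements). -/
def sumM (f : (Fin 10 → Bool) → (Fin 10 → Bool) → (Fin 10 → Bool) → ℕ) (D S : Fin 10 → Bool) : ℕ :=
  f D S mNone + f D mNone S + f S D mNone + f mNone D S + f S mNone D + f mNone S D

/-- The three pairs in the three copies (six placements). -/
def sumB (f : (Fin 10 → Bool) → (Fin 10 → Bool) → (Fin 10 → Bool) → ℕ) (S₁ S₂ S₃ : Fin 10 → Bool) : ℕ :=
  f S₁ S₂ S₃ + f S₁ S₃ S₂ + f S₂ S₁ S₃ + f S₂ S₃ S₁ + f S₃ S₁ S₂ + f S₃ S₂ S₁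

end K5

end Summit.Ventures.PercRepro2
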